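import Mathlib
import Literature.Analysis.FluidPDE.SelfSimilarEulerProfile
import Summits.NavierStokesRegularity.NavierStokesRegularity.Theorems.EulerZoomLiouvillePowerGaugeEulerLiouvilleBallisticOrbitIdentities
import Summits.NavierStokesRegularity.NavierStokesRegularity.Theorems.EulerZoomLiouvillePowerGaugeEulerLiouvilleBallisticClosures
import Summits.NavierStokesRegularity.NavierStokesRegularity.Theorems.EulerZoomLiouvillePowerGaugeEulerLiouvilleBallisticRidgeFlux

/-!
Typed companion of crux idea `Ideas/ballistic-faces.md` (ideator ns-idea-11 g7): BALLISTIC CALCULUS for the faces of `Sig.stub_selfSimilarC2Needle` — first lemmas of crux idea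
B1–B5 on stmt-NavierStokesRegularity-19832, stated over existing declarations only (rc 0).  Nothing here is a route item, a stub or a line;
provers may land any of them as TOOLS under `Theorems/…PowerGaugeEulerLiouville…` `--supports stmt-NavierStokesRegularity-19832 --as helper`.
REV 2 (20:55Z): B1–B3 are CLOSED BY NAME over width seat ns-ezl-w3 g5's p666351 `Theorems/EulerZoomLiouvillePowerGaugeEulerLiouvilleBallisticOrbitIdentities.lean`
(ns `…Theorems.PowerGaugeEulerLiouville.Ballistic`: `fderiv_transport_apply_transport`, `radialBalance`, `hasDerivAt_inner_transport_orbit/_backwardOrbit`,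
`hasDerivAt_orbitVirial` = the exact Lagrangian virial `d/dσ[e^{(1−2γ)σ}(ℋ + ½(1−2γ)⟪Y,W⟫)] = (1−2γ)e^{(1−2γ)σ}(P − ½⟪Y,∇P⟫)`, `perihelionLaw` = B4 on FORWARD
orbits with `IsLocalMin (½‖Y‖²)`); the strict/backward B4 below and B5 (free flight) remain signatures.
REV 3 (21:10Z): + (B6) `Sig.ridgeNeedsMomentumFlux` (S, TAKEABLE): `|P′ y − P′ z| ≤ M‖y−z‖` whenever `|1−γ|‖V‖ + ‖DV‖‖W‖ ≤ M` on `[y,z]` — the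
Eulerian complement to pressure capacity (sees RADIAL extent of pressurised structures; with the E-budget: cells `≲ r^{−1−ρ}` in every direction,
parked fluid near-stagnant).  B5 `Sig.freeFlight` TAKEN by ns-ezl-w1 g5 (20:56:40Z, `Theorems/…BallisticFreeFlight.lean`); wired here on ACCEPT.
REV 4 (21:10Z): B4 and B5 are CLOSED BY NAME over ns-ezl-w3 g5's `Theorems/…BallisticClosures.lean` (`Ballistic.perihelionLaw_strict_backward`,
`Ballistic.freeFlight_Icc`, bodies verbatim; on top of ns-ezl-w1 g5's `Theorems/…BallisticFreeFlight.lean` `Ballistic.freeFlight` two-mode lemmas).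
B6 is CLOSED BY NAME over ns-ezl-w2 g4's `Theorems/…BallisticRidgeFlux.lean` (`Ballistic.ridgeNeedsMomentumFlux`, verbatim; with
`norm_gradient_pressure_le : ‖∇P′ w‖ ≤ |1−γ|‖V w‖ + ‖DV w‖‖W w‖` and `ridgeNeedsMomentumFlux_of`).  ALL SIX signatures B1–B6 are tree theorems;
this file has no live signature left (0 sorry) — it is the by-name INDEX of the ballistic calculus for the faces A′/B/B♯/L♯.
-/

namespace Summit.NavierStokesRegularity.NavierStokesRegularity.Cruxes.PowerGaugeEulerLiouville.Ballistic

/-- ℝ³. -/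
abbrev E3 : Type := EuclideanSpace ℝ (Fin 3)

open Literature.Analysis.FluidPDE

/-- (B1) LAGRANGIAN ACCELERATION LAW (vector form, S): for a `C²` profile, `DW(y)[W y] = (2γ−1)·W y + γ(1−γ)·y − ∇P′(y)` with
`W = γy + V` — CIV (3.3) rewritten: similarity orbits `Y′ = W(Y)` are the trajectories of a DAMPED particle (friction `1−2γ > 0`)
in the REPULSIVE quadratic potential `−½γ(1−γ)|y|²` plus the pressure potential `P′`; `ℋ` is its mechanical energy and (3.31) its dissipation. -/
def Sig.lagrangianAcceleration : Prop :=
  ∀ (γ : ℝ) (V : E3 → E3) (P' : E3 → ℝ), IsSelfSimilarEulerProfile γ 0 V P' →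
    ∀ y : E3, fderiv ℝ (selfSimilarTransport γ 0 V) y (selfSimilarTransport γ 0 V y) =
      (2 * γ - 1) • selfSimilarTransport γ 0 V y + (γ * (1 - γ)) • y - gradient P' y

/-- (B2) LAGRANGIAN RADIAL BALANCE (scalar form, S): `⟪y, DW(y)[W y]⟫ = (2γ−1)⟪y, W y⟫ + γ(1−γ)‖y‖² − ⟪y, ∇P′(y)⟫`. -/
def Sig.radialBalance : Prop :=
  ∀ (γ : ℝ) (V : E3 → E3) (P' : E3 → ℝ), IsSelfSimilarEulerProfile γ 0 V P' →
    ∀ y : E3, inner ℝ y (fderiv ℝ (selfSimilarTransport γ 0 V) y (selfSimilarTransport γ 0 V y)) =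
      (2 * γ - 1) * inner ℝ y (selfSimilarTransport γ 0 V y) + γ * (1 - γ) * ‖y‖ ^ 2 - inner ℝ y (gradient P' y)

/-- (B3) ORBIT VIRIAL (M): along a backward arc `Y′ = −W(Y)` the radial momentum `G = ⟪Y, W(Y)⟫ = −½ d‖Y‖²/dσ` obeys
`dG/dσ = −(‖W(Y)‖² + (2γ−1) G + γ(1−γ)‖Y‖² − ⟪Y, ∇P′(Y)⟫)`. -/
def Sig.orbitVirial : Prop :=
  ∀ (γ : ℝ) (V : E3 → E3) (P' : E3 → ℝ), IsSelfSimilarEulerProfile γ 0 V P' →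
    ∀ (Y : ℝ → E3) (σ : ℝ), HasDerivAt Y (-(selfSimilarTransport γ 0 V (Y σ))) σ →
      HasDerivAt (fun s => inner ℝ (Y s) (selfSimilarTransport γ 0 V (Y s)))
        (-(‖selfSimilarTransport γ 0 V (Y σ)‖ ^ 2 + (2 * γ - 1) * inner ℝ (Y σ) (selfSimilarTransport γ 0 V (Y σ)) +
            γ * (1 - γ) * ‖Y σ‖ ^ 2 - inner ℝ (Y σ) (gradient P' (Y σ)))) σ

/-- (B4) PERIHELION LAW (M): at a radial turning point `⟪Y σ, W(Y σ)⟫ = 0` of a backward arc where the RADIAL PRESSURE FORCE is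
sub-virial, `⟪Y σ, ∇P′(Y σ)⟫ < ‖W(Y σ)‖² + γ(1−γ)‖Y σ‖²` (automatic when `|∇P′| ≤ δ‖y‖`, and at every Bernoulli-high
unpressurised point when `⟪y,∇P′⟫ ≤ 2γ(1−γ)‖y‖²`), the squared radius `‖Y‖²` has a strict local MINIMUM in forward time: the point is a
PERIHELION of the orbit (closest approach of a fly-by), never an APHELION (ejecta falling back).  Aphelia need `⟪y, ∇P′(y)⟫ ≥ ‖W‖² + γ(1−γ)‖y‖²`. -/
def Sig.perihelionLaw : Prop :=
  ∀ (γ : ℝ) (V : E3 → E3) (P' : E3 → ℝ), IsSelfSimilarEulerProfile γ 0 V P' →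
    ∀ (Y : ℝ → E3) (σ₀ : ℝ), (∀ σ : ℝ, HasDerivAt Y (-(selfSimilarTransport γ 0 V (Y σ))) σ) →
      inner ℝ (Y σ₀) (selfSimilarTransport γ 0 V (Y σ₀)) = 0 →
      inner ℝ (Y σ₀) (gradient P' (Y σ₀)) < ‖selfSimilarTransport γ 0 V (Y σ₀)‖ ^ 2 + γ * (1 - γ) * ‖Y σ₀‖ ^ 2 →
        ∃ ε > 0, ∀ σ : ℝ, σ ≠ σ₀ → |σ - σ₀| < ε → ‖Y σ₀‖ < ‖Y σ‖

/-- (B5) FREE FLIGHT (M): on an arc along which the pressure force vanishes (`∇P′(Y s) = 0`), the FORWARD orbit `Y′ = W(Y)` is the explicit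
two-mode curve `Y(s) = e^{γ s}(Y₀ + V Y₀) − e^{(γ−1)s} V Y₀` (expanding mode `e^{γs}` = passive similarity drift, contracting mode
`e^{(γ−1)s}` = free fall at radial rate `1−γ`); with friction-less bookkeeping `ℋ(Y s) = −½(1−2γ)⟪Y,W⟫ + ½ e^{−(1−2γ)s}⟪Y₀ + V Y₀, V Y₀⟫`,
so the perihelion is Bernoulli-HIGH iff `⟪Y₀ + V Y₀, V Y₀⟫ > 0`, i.e. iff `|T|² > s(1−s)‖Y₀‖²` for `V Y₀ = −s Y₀ + T`, `T ⊥ Y₀` (oblique launch). -/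
def Sig.freeFlight : Prop :=
  ∀ (γ : ℝ) (V : E3 → E3) (P' : E3 → ℝ), IsSelfSimilarEulerProfile γ 0 V P' →
    ∀ (Y : ℝ → E3) (σ₁ : ℝ), 0 ≤ σ₁ →
      (∀ σ ∈ Set.Icc 0 σ₁, HasDerivAt Y (selfSimilarTransport γ 0 V (Y σ)) σ) →
      (∀ σ ∈ Set.Icc 0 σ₁, gradient P' (Y σ) = 0) →
        ∀ σ ∈ Set.Icc 0 σ₁,
          Y σ = Real.exp (γ * σ) • (Y 0 + V (Y 0)) - Real.exp ((γ - 1) * σ) • V (Y 0)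


/-- (B6) PRESSURE RIDGES NEED MOMENTUM FLUX (S; the Eulerian complement to pressure CAPACITY): the profile equation reads
`∇P′ = −(1−γ)V − DV·W` pointwise, so on any segment `[y, z]` on which `|1−γ|‖V‖ + ‖DV‖‖W‖ ≤ M` one has `|P′ y − P′ z| ≤ M‖y − z‖`
(mean value inequality for the `C¹` pressure).  USE (faces B♯ / L♯ of line needle_faces, T2): a `κ‖y‖²`-pressurised patch of diameter `d` inside
`ε‖y‖²`-unpressurised surroundings forces `sup (|1−γ|‖V‖ + ‖DV‖‖W‖) ≥ (κ−ε)‖y‖²/d` across its boundary layer IN EVERY DIRECTION, the radial one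
included (which 1-D Bernoulli capacity cannot see: radial segments have capacity zero); with the E-budget (`‖DV‖²`-mass `≲ c_E r^{1−ρ}` per dyadic shell)
and Frostman thinness `d ≲ c_E r^{−1−ρ}/κ` this bounds the RADIAL extent of pressurised structures by `≲ c_E r^{−1−ρ}/κ²` — pressurised structures
are CELLS, not channels (so «moderately pressurised slow steady jets», `s ∈ (1−γ, 1/(1+ρ)]`, which pass radial balance, the squeeze and every binder,
do not exist) — and, combined with parking `≥ O(1)` per octave (the squeeze), makes parked fluid NEAR-STAGNANT (`|W_r| ≲ r^{−1−ρ}`): the unwritten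
half of L♯'s mechanism.  [folklore: profile equation + `Convex.norm_image_sub_le_of_norm_fderiv_le`] -/
def Sig.ridgeNeedsMomentumFlux : Prop :=
  ∀ (γ : ℝ) (V : E3 → E3) (P' : E3 → ℝ), IsSelfSimilarEulerProfile γ 0 V P' →
    ∀ (y z : E3) (M : ℝ),
      (∀ w ∈ segment ℝ y z, |1 - γ| * ‖V w‖ + ‖fderiv ℝ V w‖ * ‖selfSimilarTransport γ 0 V w‖ ≤ M) →
        |P' y - P' z| ≤ M * ‖y - z‖

/-! ## REV 2 — closures by name (ns-ezl-w3 g5 p666351) -/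

/-- B1 holds: `Ballistic.fderiv_transport_apply_transport` gives `γ•W − (1−γ)•V − ∇P′`; substitute `V y = W y − γ•y`. -/
theorem lagrangianAcceleration_holds : Sig.lagrangianAcceleration := by
  intro γ V P' h y
  rw [Summit.NavierStokesRegularity.NavierStokesRegularity.Theorems.PowerGaugeEulerLiouville.Ballistic.fderiv_transport_apply_transport h y]
  have hU : V y = selfSimilarTransport γ 0 V y - γ • y := by
    rw [selfSimilarTransport_apply, sub_zero]; abel
  rw [hU]
  module

/-- B2 holds: verbatim `Ballistic.radialBalance`. -/
theorem radialBalance_holds : Sig.radialBalance := fun γ V P' h y =>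
  Summit.NavierStokesRegularity.NavierStokesRegularity.Theorems.PowerGaugeEulerLiouville.Ballistic.radialBalance h y

/-- B3 holds: `Ballistic.hasDerivAt_inner_transport_backwardOrbit` (backward arcs written with `(-1:ℝ) • W`). -/
theorem orbitVirial_holds : Sig.orbitVirial := by
  intro γ V P' h Y σ hY
  have hY' : HasDerivAt Y ((-1 : ℝ) • selfSimilarTransport γ 0 V (Y σ)) σ := by rwa [neg_one_smul]
  exact Summit.NavierStokesRegularity.NavierStokesRegularity.Theorems.PowerGaugeEulerLiouville.Ballistic.hasDerivAt_inner_transport_backwardOrbit h hY'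


/-- B4 holds (REV 4): verbatim `Ballistic.perihelionLaw_strict_backward` (ns-ezl-w3 g5). -/
theorem perihelionLaw_holds : Sig.perihelionLaw :=
  Summit.NavierStokesRegularity.NavierStokesRegularity.Theorems.PowerGaugeEulerLiouville.Ballistic.perihelionLaw_strict_backward

/-- B5 holds (REV 4): verbatim `Ballistic.freeFlight_Icc` (ns-ezl-w3 g5, over ns-ezl-w1 g5's `Ballistic.freeFlight`). -/
theorem freeFlight_holds : Sig.freeFlight :=
  Summit.NavierStokesRegularity.NavierStokesRegularity.Theorems.PowerGaugeEulerLiouville.Ballistic.freeFlight_Icc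

/-- B6 holds (REV 4): verbatim `Ballistic.ridgeNeedsMomentumFlux` (ns-ezl-w2 g4). -/
theorem ridgeNeedsMomentumFlux_holds : Sig.ridgeNeedsMomentumFlux :=
  Summit.NavierStokesRegularity.NavierStokesRegularity.Theorems.PowerGaugeEulerLiouville.Ballistic.ridgeNeedsMomentumFlux

end Summit.NavierStokesRegularity.NavierStokesRegularity.Cruxes.PowerGaugeEulerLiouville.Ballistic
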